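import Mathlib
import Literature.NumberTheory.Sieve.Maynard2016CoupledKernelWSum
import HarnessLib

/-!
# Maynard (2016), Lemma 7: the weighted coupled kernel as a limit of box sums and Euler products

Topic `Literature/NumberTheory/Sieve`; trunk AntSieve / parity (Maynard 2016 large-gaps ladder, named
fact `Literature.NumberTheory.Sieve.Maynard2016.Lemma7Tuple` of `Maynard2016Lemma7PerTuple.lean`).

J. Maynard, *Large gaps between primes*, Ann. of Math. (2) 183 (2016), 915–933 = arXiv:1408.5110,
§6: (6.8)–(6.11) and Lemma 7 (6.32).  Port of the last section of `Maynard2016CoupledKernel` to the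
weighted kernel `coupledKernelW w` (`IsLcmWeight w`, e.g. `w = 1/φ`): the sums of the weighted terms
over the boxes `[1,D]^{2k₁} × [1,D]^{2k₂}` tend to `K^w` (`tendsto_sum_box_coupledEulerTermW`), and
the finite Euler products `∏_{p < N, p ∤ W} K^w_p` tend to `K^w` (`tendsto_prod_coupledLocalFactorMuW`).

## References

* J. Maynard, *Large gaps between primes*, Ann. of Math. (2) 183 (2016), 915–933; arXiv:1408.5110,
  §6, (6.8)–(6.11) and (6.32). [Maynard2016LargeGaps]
-/

noncomputable section

open Filter Finset ArithmeticFunction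
open scoped BigOperators Topology ArithmeticFunction.Moebius Classical

namespace Literature.NumberTheory.Sieve

namespace LcmEuler

variable {ι κ : Type*} [Fintype ι] [DecidableEq ι] [Fintype κ] [DecidableEq κ]

/-! ### Box partial sums and prime partial products converge to `K^w` -/

/-- **The sum over the boxes `[1,D]^{2k₁} × [1,D]^{2k₂}` tends to `K^w` as `D → ∞`** (the passage
from the finite sum to the series, for the weighted kernel of (6.32)).
[cite: Maynard2016LargeGaps, §6 displays (6.8)–(6.10) and Lemma 7 (6.32)] -/
theorem tendsto_sum_box_coupledEulerTermW {w : ℕ → ℂ} (hw : IsLcmWeight w) {W m : ℕ} (M : ℕ → Finset (ι × κ)) {a b : ι → ℂ}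
    {a' b' : κ → ℂ} {σ : ℝ} (hσ : 0 < σ) (hab : ∀ i, σ ≤ (a i).re ∧ σ ≤ (b i).re)
    (hab' : ∀ j, σ ≤ (a' j).re ∧ σ ≤ (b' j).re) :
    Tendsto (fun D : ℕ => ∑ t ∈ (lcmBox ι D ×ˢ lcmBox ι D) ×ˢ (lcmBox κ D ×ˢ lcmBox κ D),
      coupledEulerTermW w W m M a b a' b' t) atTop (𝓝 (coupledKernelW w W m M a b a' b')) := by
  -- the index set on which the boxes are cofinal
  set S : Set (((ι → ℕ) × (ι → ℕ)) × ((κ → ℕ) × (κ → ℕ))) :=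
    {t | (∀ i, 1 ≤ t.1.1 i ∧ 1 ≤ t.1.2 i) ∧ ∀ j, 1 ≤ t.2.1 j ∧ 1 ≤ t.2.2 j} with hSdef
  have hsupp : Function.support (coupledEulerTermW w W m M a b a' b') ⊆ S := by
    intro t ht
    obtain ⟨_, hsqD, hsqE⟩ := support_coupledEulerTermW ht
    exact ⟨fun i => ⟨Nat.pos_of_ne_zero (hsqD i).1.ne_zero, Nat.pos_of_ne_zero (hsqD i).2.ne_zero⟩,
      fun j => ⟨Nat.pos_of_ne_zero (hsqE j).1.ne_zero, Nat.pos_of_ne_zero (hsqE j).2.ne_zero⟩⟩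
  have hX : HasSum ((coupledEulerTermW w W m M a b a' b') ∘ (↑) : S → ℂ)
      (coupledKernelW w W m M a b a' b') :=
    (hasSum_subtype_iff_of_support_subset hsupp).2 (hasSum_coupledEulerTermW hw M hσ hab hab')
  set B : ℕ → Finset S := fun D =>
    ((lcmBox ι D ×ˢ lcmBox ι D) ×ˢ (lcmBox κ D ×ˢ lcmBox κ D)).subtype (· ∈ S) with hBdef
  have hBmono : Monotone B := by
    intro D D' hDD' t ht
    simp only [hBdef, Finset.mem_subtype, Finset.mem_product, lcmBox, Fintype.mem_piFinset,
      Finset.mem_Icc] at ht ⊢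
    exact ⟨⟨fun i => ⟨(ht.1.1 i).1, (ht.1.1 i).2.trans hDD'⟩, fun i => ⟨(ht.1.2 i).1, (ht.1.2 i).2.trans hDD'⟩⟩,
      fun j => ⟨(ht.2.1 j).1, (ht.2.1 j).2.trans hDD'⟩, fun j => ⟨(ht.2.2 j).1, (ht.2.2 j).2.trans hDD'⟩⟩
  have hBcof : ∀ t : S, ∃ D, t ∈ B D := by
    intro t
    refine ⟨max (Finset.univ.sup fun i => max (t.1.1.1 i) (t.1.1.2 i))
      (Finset.univ.sup fun j => max (t.1.2.1 j) (t.1.2.2 j)), ?_⟩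
    have ht : (t : ((ι → ℕ) × (ι → ℕ)) × ((κ → ℕ) × (κ → ℕ))) ∈ S := t.2
    simp only [hSdef, Set.mem_setOf_eq] at ht
    simp only [hBdef, Finset.mem_subtype, Finset.mem_product, lcmBox, Fintype.mem_piFinset,
      Finset.mem_Icc]
    have hle1 : ∀ i, max (t.1.1.1 i) (t.1.1.2 i) ≤ Finset.univ.sup fun i => max (t.1.1.1 i) (t.1.1.2 i) :=
      fun i => Finset.le_sup (f := fun i => max (t.1.1.1 i) (t.1.1.2 i)) (Finset.mem_univ i)
    have hle2 : ∀ j, max (t.1.2.1 j) (t.1.2.2 j) ≤ Finset.univ.sup fun j => max (t.1.2.1 j) (t.1.2.2 j) :=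
      fun j => Finset.le_sup (f := fun j => max (t.1.2.1 j) (t.1.2.2 j)) (Finset.mem_univ j)
    refine ⟨⟨fun i => ⟨(ht.1 i).1, ?_⟩, fun i => ⟨(ht.1 i).2, ?_⟩⟩, fun j => ⟨(ht.2 j).1, ?_⟩,
      fun j => ⟨(ht.2 j).2, ?_⟩⟩
    · exact ((le_max_left _ _).trans (hle1 i)).trans (le_max_left _ _)
    · exact ((le_max_right _ _).trans (hle1 i)).trans (le_max_left _ _)
    · exact ((le_max_left _ _).trans (hle2 j)).trans (le_max_right _ _)
    · exact ((le_max_right _ _).trans (hle2 j)).trans (le_max_right _ _)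
  have hBtend : Tendsto B atTop atTop := tendsto_atTop_finset_of_monotone hBmono hBcof
  have hX' : Tendsto (fun s : Finset S => ∑ y ∈ s, ((coupledEulerTermW w W m M a b a' b') ∘ (↑)) y)
      atTop (𝓝 (coupledKernelW w W m M a b a' b')) := by
    have := hX
    rw [HasSum] at this
    simpa only [SummationFilter.unconditional_filter] using this
  have key := hX'.comp hBtend
  refine key.congr fun D => ?_
  simp only [Function.comp_def, hBdef]
  rw [Finset.sum_subtype_eq_sum_filter, Finset.filter_true_of_mem]
  intro t ht
  simp only [Finset.mem_product, lcmBox, Fintype.mem_piFinset, Finset.mem_Icc] at ht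
  exact ⟨fun i => ⟨(ht.1.1 i).1, (ht.1.2 i).1⟩, fun j => ⟨(ht.2.1 j).1, (ht.2.2 j).1⟩⟩

/-- **`K^w = ∏_p K^w_p`**: the weighted Euler products over the primes `p < N`, `p ∤ W` tend to `K^w`
("we can rewrite the sum as a product `∏_p K_p`", p. 10; (6.32) for the weight `1/φ`).
[cite: Maynard2016LargeGaps, §6 display (6.11) and Lemma 7 (6.32)] -/
theorem tendsto_prod_coupledLocalFactorMuW {w : ℕ → ℂ} (hw : IsLcmWeight w) {W m : ℕ} (M : ℕ → Finset (ι × κ)) {a b : ι → ℂ}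
    {a' b' : κ → ℂ} {σ : ℝ} (hσ : 0 < σ) (hab : ∀ i, σ ≤ (a i).re ∧ σ ≤ (b i).re)
    (hab' : ∀ j, σ ≤ (a' j).re ∧ σ ≤ (b' j).re) :
    Tendsto (fun N : ℕ => ∏ q ∈ primesBelowNotDvd W N, coupledLocalFactorMuW w m M a b a' b' q) atTop
      (𝓝 (coupledKernelW w W m M a b a' b')) := by
  set S : Set (((ι → ℕ) × (ι → ℕ)) × ((κ → ℕ) × (κ → ℕ))) :=
    {t | GoodPair W t.1 ∧ GoodPair W t.2} with hSdef
  have hsupp : Function.support (coupledEulerTermW w W m M a b a' b') ⊆ S :=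
    fun t ht => goodPair_of_coupledEulerTermW_ne_zero ht
  have hX : HasSum ((coupledEulerTermW w W m M a b a' b') ∘ (↑) : S → ℂ)
      (coupledKernelW w W m M a b a' b') :=
    (hasSum_subtype_iff_of_support_subset hsupp).2 (hasSum_coupledEulerTermW hw M hσ hab hab')
  set B : ℕ → Finset S := fun N =>
    (pairBox ι (primesBelowNotDvd W N) ×ˢ pairBox κ (primesBelowNotDvd W N)).subtype (· ∈ S)
    with hBdef
  have hBmono : Monotone B := by
    intro N N' hNN' t ht
    simp only [hBdef, Finset.mem_subtype] at ht ⊢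
    have hsub : primesBelowNotDvd W N ⊆ primesBelowNotDvd W N' := primesBelowNotDvd_mono W hNN'
    have hdvd : (∏ q ∈ primesBelowNotDvd W N, q) ∣ ∏ q ∈ primesBelowNotDvd W N', q :=
      Finset.prod_dvd_prod_of_subset _ _ _ hsub
    have hne : (∏ q ∈ primesBelowNotDvd W N', q) ≠ 0 :=
      Finset.prod_ne_zero_iff.2 fun q hq => (prime_of_mem_primesBelowNotDvd hq).ne_zero
    simp only [pairBox, Finset.mem_product, Fintype.mem_piFinset, Nat.mem_divisors] at ht ⊢
    exact ⟨⟨fun i => ⟨(ht.1.1 i).1.trans hdvd, hne⟩, fun i => ⟨(ht.1.2 i).1.trans hdvd, hne⟩⟩,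
      fun j => ⟨(ht.2.1 j).1.trans hdvd, hne⟩, fun j => ⟨(ht.2.2 j).1.trans hdvd, hne⟩⟩
  have hBcof : ∀ t : S, ∃ N, t ∈ B N := by
    intro t
    have ht : (t : ((ι → ℕ) × (ι → ℕ)) × ((κ → ℕ) × (κ → ℕ))) ∈ S := t.2
    simp only [hSdef, Set.mem_setOf_eq] at ht
    refine ⟨max (Finset.univ.sup fun i => max (t.1.1.1 i) (t.1.1.2 i))
      (Finset.univ.sup fun j => max (t.1.2.1 j) (t.1.2.2 j)) + 1, ?_⟩
    simp only [hBdef, Finset.mem_subtype, Finset.mem_product]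
    have hle1 : ∀ i, max (t.1.1.1 i) (t.1.1.2 i) ≤ Finset.univ.sup fun i => max (t.1.1.1 i) (t.1.1.2 i) :=
      fun i => Finset.le_sup (f := fun i => max (t.1.1.1 i) (t.1.1.2 i)) (Finset.mem_univ i)
    have hle2 : ∀ j, max (t.1.2.1 j) (t.1.2.2 j) ≤ Finset.univ.sup fun j => max (t.1.2.1 j) (t.1.2.2 j) :=
      fun j => Finset.le_sup (f := fun j => max (t.1.2.1 j) (t.1.2.2 j)) (Finset.mem_univ j)
    refine ⟨mem_pairBox_of_goodPair ht.1 fun i => ?_, mem_pairBox_of_goodPair ht.2 fun j => ?_⟩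
    · have := hle1 i
      have h2 := le_max_left (Finset.univ.sup fun i => max (t.1.1.1 i) (t.1.1.2 i))
        (Finset.univ.sup fun j => max (t.1.2.1 j) (t.1.2.2 j))
      constructor <;> omega
    · have := hle2 j
      have h2 := le_max_right (Finset.univ.sup fun i => max (t.1.1.1 i) (t.1.1.2 i))
        (Finset.univ.sup fun j => max (t.1.2.1 j) (t.1.2.2 j))
      constructor <;> omega
  have hBtend : Tendsto B atTop atTop := tendsto_atTop_finset_of_monotone hBmono hBcof
  have hX' : Tendsto (fun s : Finset S => ∑ y ∈ s, ((coupledEulerTermW w W m M a b a' b') ∘ (↑)) y)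
      atTop (𝓝 (coupledKernelW w W m M a b a' b')) := by
    have := hX
    rw [HasSum] at this
    simpa only [SummationFilter.unconditional_filter] using this
  have key := hX'.comp hBtend
  refine key.congr fun N => ?_
  simp only [Function.comp_def, hBdef]
  rw [Finset.sum_subtype_eq_sum_filter, Finset.filter_true_of_mem (fun t ht => ?_)]
  · rw [Finset.sum_product]
    exact sum_pairBox_coupledEulerTermW (fun q hq => prime_of_mem_primesBelowNotDvd hq)
      (fun q hq => not_dvd_of_mem_primesBelowNotDvd hq) hw.mult m M a b a' b'
  · obtain ⟨h1, h2⟩ := Finset.mem_product.1 ht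
    exact ⟨goodPair_of_mem_pairBox h1, goodPair_of_mem_pairBox h2⟩

end LcmEuler

end Literature.NumberTheory.Sieve

end
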